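import Literature.Topology.PlanarFoliations.CircleLoops
import Literature.Topology.PlanarFoliations.StabilityBand
import Mathlib.AlgebraicTopology.FundamentalGroupoid.Basic
import HarnessLib

/-!
# Null-homotopy of the image of a circle does not depend on the injective loop

Topic: Topology / PlanarFoliations (generic circle topology, sequel to `CircleLoops.lean`). Let
`Y` be a circle parametrised by an injective loop `β` (continuous, `1`-periodic, injective on
`[0, 1)`, onto) and `Φ : C(Y, Z)` a continuous map (for us: the filling map of a disc, from a
compact leaf of the contour foliation into the leaf space of the ambient foliation). Whether the
image loop `Φ ∘ β` is null-homotopic in `Z` does not depend on the injective parametrisation: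

* `map_loop_rebase_homotopic_refl` (**proved**): it does not depend on the base point — the
  re-based loop `β(· + s₀)` is, up to homotopy, the conjugate `B · A` of `β = A · B` by the arc
  `A = β|[0, s₀]` (explicit lifts `CircleLoops.homotopic_loop_of_lift_eq_one`), and in the
  fundamental groupoid `A · B ≃ 1` implies `B · A ≃ 1`.
* `map_loop_homotopic_refl_of_map_loop` (**proved**): it does not depend on the injective loop at
  all — any other injective loop `β'` onto `Y` is homotopic to the re-based `β` or its reverse
  (the degree-one criterion `CircleLoops.homotopic_loop_or_revLoop`, read in an arc chart at
  `β' 0`, its side condition supplied by `mul_neg_of_injective_ends` of `StabilityBand.lean`),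
  and reversing a loop reverses its image.
* `injOn_Ico_of_periodic` (**proved**): injectivity on every half-open period.

All statements are [folklore].
-/

noncomputable section

open Set Filter Function
open _root_.Topology unitInterval

namespace Literature.Topology.PlanarFoliations

namespace CircleLoops

variable {Y : Type*} [TopologicalSpace Y] {Z : Type*} [TopologicalSpace Z] {β : ℝ → Y}

/-! ## Periods -/

/-- A `1`-periodic map injective on `[0, 1)` is injective on every half-open interval of length
`1`. [folklore] -/
theorem injOn_Ico_of_periodic {α : Type*} {γ : ℝ → α} (hp : Periodic γ 1) (hinj : InjOn γ (Ico 0 1))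
    (a : ℝ) : InjOn γ (Ico a (a + 1)) := by
  intro s hs t ht hst
  rw [← apply_fract hp s, ← apply_fract hp t] at hst
  have hfr : Int.fract s = Int.fract t :=
    hinj ⟨Int.fract_nonneg s, Int.fract_lt_one s⟩ ⟨Int.fract_nonneg t, Int.fract_lt_one t⟩ hst
  rw [Int.fract_eq_fract] at hfr
  obtain ⟨k, hk⟩ := hfr
  have hlt : |s - t| < 1 := by rw [abs_lt]; constructor <;> linarith [hs.1, hs.2, ht.1, ht.2]
  rw [hk] at hlt
  have hk0 : k = 0 := by
    have h' : |(k : ℝ)| < 1 := hlt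
    rw [← Int.cast_abs] at h'
    have h'' : |k| < 1 := by exact_mod_cast h'
    exact Int.abs_lt_one_iff.1 h''
  have : s - t = 0 := by rw [hk, hk0]; simp
  linarith

/-- The translate `β(· + s₀)` of an injective loop onto `Y` is an injective loop onto `Y`.
[folklore] -/
theorem rebase (hc : Continuous β) (hp : Periodic β 1) (hinj : InjOn β (Ico 0 1)) (hsurj : range β = univ)
    (s₀ : ℝ) :
    Continuous (fun s ↦ β (s + s₀)) ∧ Periodic (fun s ↦ β (s + s₀)) 1 ∧
      InjOn (fun s ↦ β (s + s₀)) (Ico 0 1) ∧ range (fun s ↦ β (s + s₀)) = univ := by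
  refine ⟨hc.comp (continuous_id.add continuous_const), fun s ↦ ?_, ?_, ?_⟩
  · show β (s + 1 + s₀) = β (s + s₀)
    rw [show s + 1 + s₀ = (s + s₀) + 1 by ring]
    exact hp _
  · intro s hs t ht hst
    have h := injOn_Ico_of_periodic hp hinj s₀ ⟨by linarith [hs.1], by linarith [hs.2]⟩
      ⟨by linarith [ht.1], by linarith [ht.2]⟩ hst
    linarith
  · refine eq_univ_of_forall fun y ↦ ?_
    obtain ⟨u, rfl⟩ : y ∈ range β := by rw [hsurj]; exact mem_univ y
    exact ⟨u - s₀, by simp⟩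

/-! ## Splitting the loop at a parameter `s₀ ∈ [0, 1]` -/

/-- The first arc `θ ↦ β (s₀ θ)` of the loop, from `β 0` to `β s₀`. [folklore] -/
def arcTo (hc : Continuous β) (s₀ : ℝ) : Path (β 0) (β s₀) where
  toFun θ := β (s₀ * θ)
  continuous_toFun := hc.comp (continuous_const.mul continuous_subtype_val)
  source' := by simp
  target' := by simp

/-- The second arc `θ ↦ β (s₀ + (1 - s₀) θ)` of the loop, from `β s₀` back to `β 0`. [folklore] -/
def arcFrom (hc : Continuous β) (hp : Periodic β 1) (s₀ : ℝ) : Path (β s₀) (β 0) where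
  toFun θ := β (s₀ + (1 - s₀) * θ)
  continuous_toFun := hc.comp (continuous_const.add (continuous_const.mul continuous_subtype_val))
  source' := by simp
  target' := by
    show β (s₀ + (1 - s₀) * 1) = β 0
    rw [mul_one, add_sub_cancel, ← zero_add (1 : ℝ)]
    exact hp 0

/-- The values of `arcTo`. [folklore] -/
@[simp] theorem arcTo_apply (hc : Continuous β) (s₀ : ℝ) (θ : I) : arcTo hc s₀ θ = β (s₀ * θ) := rfl

/-- The values of `arcFrom`. [folklore] -/
@[simp] theorem arcFrom_apply (hc : Continuous β) (hp : Periodic β 1) (s₀ : ℝ) (θ : I) :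
    arcFrom hc hp s₀ θ = β (s₀ + (1 - s₀) * θ) := rfl

/-- The piecewise linear lift `s₀ · min(2θ, 1) + s₁ · max(2θ - 1, 0)`. [folklore] -/
def pwLift (s₀ s₁ : ℝ) : C(I, ℝ) where
  toFun θ := s₀ * min (2 * (θ : ℝ)) 1 + s₁ * max (2 * (θ : ℝ) - 1) 0
  continuous_toFun := by
    have h : Continuous fun θ : I ↦ (θ : ℝ) := continuous_subtype_val
    exact (continuous_const.mul ((continuous_const.mul h).min continuous_const)).add
      (continuous_const.mul (((continuous_const.mul h).sub continuous_const).max continuous_const))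

/-- The lift on the first half. [folklore] -/
theorem pwLift_of_le (s₀ s₁ : ℝ) {θ : I} (h : (θ : ℝ) ≤ 1 / 2) : pwLift s₀ s₁ θ = s₀ * (2 * θ) := by
  show s₀ * min (2 * (θ : ℝ)) 1 + s₁ * max (2 * (θ : ℝ) - 1) 0 = _
  rw [min_eq_left (by linarith), max_eq_right (by linarith), mul_zero, add_zero]

/-- The lift on the second half. [folklore] -/
theorem pwLift_of_ge (s₀ s₁ : ℝ) {θ : I} (h : 1 / 2 ≤ (θ : ℝ)) : pwLift s₀ s₁ θ = s₀ + s₁ * (2 * θ - 1) := by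
  show s₀ * min (2 * (θ : ℝ)) 1 + s₁ * max (2 * (θ : ℝ) - 1) 0 = _
  rw [min_eq_right (by linarith), max_eq_left (by linarith), mul_one]

/-- The lift starts at `0`. [folklore] -/
theorem pwLift_zero (s₀ s₁ : ℝ) : pwLift s₀ s₁ 0 = 0 := by
  rw [pwLift_of_le s₀ s₁ (by show ((0 : I) : ℝ) ≤ 1 / 2; norm_num)]
  show s₀ * (2 * 0) = 0
  ring

/-- The lift ends at `s₀ + s₁`. [folklore] -/
theorem pwLift_one (s₀ s₁ : ℝ) : pwLift s₀ s₁ 1 = s₀ + s₁ := by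
  rw [pwLift_of_ge s₀ s₁ (by show (1 : ℝ) / 2 ≤ ((1 : I) : ℝ); norm_num)]
  show s₀ + s₁ * (2 * 1 - 1) = s₀ + s₁
  ring

/-- **The loop is homotopic to the concatenation of its two arcs** (both lift to paths of the line
from `0` to `1`). [folklore] -/
theorem arcTo_trans_arcFrom_homotopic (hc : Continuous β) (hp : Periodic β 1) (s₀ : ℝ) :
    ((arcTo hc s₀).trans (arcFrom hc hp s₀)).Homotopic (loop hc hp) := by
  refine homotopic_loop_of_lift_eq_one hc hp _ (pwLift s₀ (1 - s₀)) (pwLift_zero _ _) (fun θ ↦ ?_)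
    (by rw [pwLift_one]; ring)
  rw [Path.trans_apply]
  split_ifs with h
  · rw [pwLift_of_le _ _ h]
    rfl
  · rw [pwLift_of_ge _ _ (not_le.1 h).le]
    rfl

/-- **The re-based loop is homotopic to the concatenation of the two arcs in the other order**
(lift `(1 - s₀) · min(2θ, 1) + s₀ · max(2θ - 1, 0)`, using periodicity on the second half).
[folklore] -/
theorem arcFrom_trans_arcTo_homotopic (hc : Continuous β) (hp : Periodic β 1) (s₀ : ℝ)
    (hc₁ : Continuous fun s ↦ β (s + s₀)) (hp₁ : Periodic (fun s ↦ β (s + s₀)) 1)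
    (e : β (0 + s₀) = β s₀) :
    (((arcFrom hc hp s₀).trans (arcTo hc s₀)).cast e e).Homotopic (loop hc₁ hp₁) := by
  refine homotopic_loop_of_lift_eq_one hc₁ hp₁ _ (pwLift (1 - s₀) s₀) (pwLift_zero _ _) (fun θ ↦ ?_)
    (by rw [pwLift_one]; ring)
  show β (pwLift (1 - s₀) s₀ θ + s₀) = ((arcFrom hc hp s₀).trans (arcTo hc s₀)) θ
  rw [Path.trans_apply]
  split_ifs with h
  · rw [pwLift_of_le _ _ h]
    show β ((1 - s₀) * (2 * θ) + s₀) = β (s₀ + (1 - s₀) * _)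
    ring_nf
  · rw [pwLift_of_ge _ _ (not_le.1 h).le]
    show β (1 - s₀ + s₀ * (2 * θ - 1) + s₀) = β (s₀ * _)
    rw [show 1 - s₀ + s₀ * (2 * (θ : ℝ) - 1) + s₀ = s₀ * (2 * θ - 1) + 1 by ring]
    exact hp _

/-! ## Conjugation in the fundamental groupoid -/

/-- **In the fundamental groupoid, `A · B ≃ 1` implies `B · A ≃ 1`.** [folklore] -/
theorem trans_homotopic_refl_of_trans_homotopic_refl {W : Type*} [TopologicalSpace W] {a b : W}
    (A : Path a b) (B : Path b a) (h : (A.trans B).Homotopic (Path.refl a)) :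
    (B.trans A).Homotopic (Path.refl b) := by
  have h₁ : (B.trans A).Homotopic ((B.trans A).trans (Path.refl b)) := ⟨(Path.Homotopy.transRefl _).symm⟩
  have h₂ : ((B.trans A).trans (Path.refl b)).Homotopic ((B.trans A).trans (B.trans B.symm)) :=
    Path.Homotopic.hcomp (Path.Homotopic.refl _) ⟨Path.Homotopy.reflTransSymm B⟩
  have h₃ : ((B.trans A).trans (B.trans B.symm)).Homotopic (((B.trans A).trans B).trans B.symm) :=
    ⟨(Path.Homotopy.transAssoc _ _ _).symm⟩
  have h₄ : (((B.trans A).trans B).trans B.symm).Homotopic ((B.trans (A.trans B)).trans B.symm) :=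
    Path.Homotopic.hcomp ⟨Path.Homotopy.transAssoc _ _ _⟩ (Path.Homotopic.refl _)
  have h₅ : ((B.trans (A.trans B)).trans B.symm).Homotopic ((B.trans (Path.refl a)).trans B.symm) :=
    Path.Homotopic.hcomp (Path.Homotopic.hcomp (Path.Homotopic.refl _) h) (Path.Homotopic.refl _)
  have h₆ : ((B.trans (Path.refl a)).trans B.symm).Homotopic (B.trans B.symm) :=
    Path.Homotopic.hcomp ⟨Path.Homotopy.transRefl _⟩ (Path.Homotopic.refl _)
  have h₇ : (B.trans B.symm).Homotopic (Path.refl b) := ⟨(Path.Homotopy.reflTransSymm B).symm⟩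
  exact ((((((h₁.trans h₂).trans h₃).trans h₄).trans h₅).trans h₆).trans h₇)

/-! ## Independence of the base point -/

/-- Casting commutes with mapping. [folklore] -/
theorem map_cast {W : Type*} [TopologicalSpace W] {a b a' b' : Y} (p : Path a b) (ea : a' = a)
    (eb : b' = b) (Φ : C(Y, W)) :
    (p.cast ea eb).map Φ.continuous = (p.map Φ.continuous).cast (congrArg Φ ea) (congrArg Φ eb) := by
  ext θ
  rfl

/-- Homotopy of paths is insensitive to casting the end points. [folklore] -/
theorem homotopic_of_cast {W : Type*} [TopologicalSpace W] {x y x' y' : W} {p q : Path x y}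
    (e₁ : x' = x) (e₂ : y' = y) (h : (p.cast e₁ e₂).Homotopic (q.cast e₁ e₂)) : p.Homotopic q := by
  subst e₁ e₂
  exact h

/-- Homotopy of paths is insensitive to casting the end points. [folklore] -/
theorem homotopic_cast {W : Type*} [TopologicalSpace W] {x y x' y' : W} {p q : Path x y}
    (e₁ : x' = x) (e₂ : y' = y) (h : p.Homotopic q) : (p.cast e₁ e₂).Homotopic (q.cast e₁ e₂) := by
  subst e₁ e₂
  exact h

/-- **Null-homotopy of the image loop does not depend on the base point**: if `Φ ∘ β` is
null-homotopic then so is the image of the re-based loop `β(· + s₀)`, for `s₀ ∈ [0, 1]`.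
[folklore] -/
theorem map_loop_rebase_homotopic_refl (hc : Continuous β) (hp : Periodic β 1) {s₀ : ℝ}
    (hc₁ : Continuous fun s ↦ β (s + s₀)) (hp₁ : Periodic (fun s ↦ β (s + s₀)) 1) (Φ : C(Y, Z))
    (hnull : ((loop hc hp).map Φ.continuous).Homotopic (Path.refl _)) :
    ((loop hc₁ hp₁).map Φ.continuous).Homotopic (Path.refl _) := by
  have e : β (0 + s₀) = β s₀ := by rw [zero_add]
  -- `A · B ≃ β ≃ 1` after `Φ`
  have hAB : (((arcTo hc s₀).map Φ.continuous).trans ((arcFrom hc hp s₀).map Φ.continuous)).Homotopic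
      (Path.refl _) := by
    rw [← Path.map_trans]
    exact ((arcTo_trans_arcFrom_homotopic hc hp s₀).map Φ).trans hnull
  -- hence `B · A ≃ 1` after `Φ`
  have hBA := trans_homotopic_refl_of_trans_homotopic_refl _ _ hAB
  rw [← Path.map_trans] at hBA
  -- and `B · A` is the re-based loop
  have hQ := (arcFrom_trans_arcTo_homotopic hc hp s₀ hc₁ hp₁ e).map Φ
  rw [map_cast] at hQ
  have hrefl : (Path.refl (Φ (β s₀))).cast (congrArg Φ e) (congrArg Φ e) = Path.refl (Φ (β (0 + s₀))) := by
    ext θ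
    exact congrArg Φ e.symm
  have hBA' := homotopic_cast (congrArg Φ e) (congrArg Φ e) hBA
  rw [hrefl] at hBA'
  exact hQ.symm.trans hBA'

/-! ## Independence of the injective loop -/

/-- The reversed loop is the reverse path of the loop (periodicity). [folklore] -/
theorem revLoop_eq_symm (hc : Continuous β) (hp : Periodic β 1) : revLoop hc hp = (loop hc hp).symm := by
  ext θ
  show β (-(θ : ℝ)) = β (σ θ)
  rw [coe_symm_eq, show (1 : ℝ) - θ = -θ + 1 by ring]
  exact (hp _).symm

/-- **Null-homotopy of the image of a circle does not depend on the injective loop.** Let `β` and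
`β'` be injective loops into the Hausdorff space `Y`, `β` onto, `c` an arc chart of `Y` at `β' 0` (an open
partial homeomorphism onto the line), and `Φ : C(Y, Z)`. If `Φ ∘ β` is null-homotopic then so is
`Φ ∘ β'`: re-base `β` at `β' 0`; by the degree-one criterion `β'` is homotopic to the re-based
loop or to its reverse. [folklore] -/
theorem map_loop_homotopic_refl_of_map_loop [T2Space Y] (hc : Continuous β) (hp : Periodic β 1)
    (hinj : InjOn β (Ico 0 1)) (hsurj : range β = univ) {β' : ℝ → Y} (hc' : Continuous β') (hp' : Periodic β' 1)
    (hinj' : InjOn β' (Ico 0 1)) {c : OpenPartialHomeomorph Y ℝ} (hct : c.target = univ)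
    (h0 : β' 0 ∈ c.source) (Φ : C(Y, Z)) (hnull : ((loop hc hp).map Φ.continuous).Homotopic (Path.refl _)) :
    ((loop hc' hp').map Φ.continuous).Homotopic (Path.refl _) := by
  -- re-base `β` at `β' 0`
  obtain ⟨s₁, hs₁⟩ : β' 0 ∈ range β := by rw [hsurj]; exact mem_univ _
  set s₀ : ℝ := Int.fract s₁ with hs₀def
  have hs₀ : β s₀ = β' 0 := by rw [hs₀def, apply_fract hp, hs₁]
  obtain ⟨hc₁, hp₁, hinj₁, hsurj₁⟩ := rebase hc hp hinj hsurj s₀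
  set β₁ : ℝ → Y := fun s ↦ β (s + s₀) with hβ₁
  have hrebase := map_loop_rebase_homotopic_refl hc hp (s₀ := s₀) hc₁ hp₁ Φ hnull
  have e : β₁ 0 = β' 0 := by show β (0 + s₀) = β' 0; rw [zero_add, hs₀]
  -- the loop `β'` as a loop at `β₁ 0`
  set h : Path (β₁ 0) (β₁ 0) := (loop hc' hp').cast e e with hh
  have hhap : ∀ θ : I, h θ = β' θ := fun θ ↦ rfl
  -- the parameter `θ₁`: both ends of `β'` in the source of `c`
  have hpre : IsOpen ((fun θ : I ↦ β' θ) ⁻¹' c.source) :=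
    c.open_source.preimage (hc'.comp continuous_subtype_val)
  have h0I : (0 : I) ∈ (fun θ : I ↦ β' θ) ⁻¹' c.source := h0
  have h1I : (1 : I) ∈ (fun θ : I ↦ β' θ) ⁻¹' c.source := by
    show β' (1 : ℝ) ∈ c.source
    rw [← zero_add (1 : ℝ), hp' 0]
    exact h0
  obtain ⟨r₀, hr₀, hball₀⟩ := Metric.mem_nhds_iff.1 (hpre.mem_nhds h0I)
  obtain ⟨r₁, hr₁, hball₁⟩ := Metric.mem_nhds_iff.1 (hpre.mem_nhds h1I)
  set t : ℝ := min (min r₀ r₁) (1 / 3) / 2 with htdef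
  have ht₀ : 0 < t := by positivity
  have htr₀ : t < r₀ := by
    have : min (min r₀ r₁) (1 / 3) ≤ r₀ := (min_le_left _ _).trans (min_le_left _ _)
    rw [htdef]; linarith
  have htr₁ : t < r₁ := by
    have : min (min r₀ r₁) (1 / 3) ≤ r₁ := (min_le_left _ _).trans (min_le_right _ _)
    rw [htdef]; linarith
  have ht6 : t ≤ 1 / 6 := by
    have : min (min r₀ r₁) (1 / 3) ≤ 1 / 3 := min_le_right _ _
    rw [htdef]; linarith
  have ht₁ : t < 1 := by linarith
  have hthalf : t < 1 / 2 := by linarith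
  set θ₁ : I := ⟨t, ht₀.le, ht₁.le⟩ with hθ₁def
  have hsrc : ∀ θ : I, (θ : ℝ) ≤ t ∨ 1 - t ≤ (θ : ℝ) → β' θ ∈ c.source := by
    rintro θ (hθ | hθ)
    · exact hball₀ (by
        rw [Metric.mem_ball, Subtype.dist_eq, Real.dist_eq, show ((0 : I) : ℝ) = 0 from rfl, sub_zero,
          abs_of_nonneg θ.2.1]
        linarith)
    · exact hball₁ (by
        rw [Metric.mem_ball, Subtype.dist_eq, Real.dist_eq, show ((1 : I) : ℝ) = 1 from rfl, abs_sub_comm,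
          abs_of_nonneg (by linarith [θ.2.2])]
        linarith [θ.2.2])
  -- (a), (b), (c) of the degree-one criterion for `h`
  have ha : ∀ θ : I, (θ : ℝ) ≤ θ₁ ∨ 1 - θ₁ ≤ (θ : ℝ) → h θ ∈ c.source := fun θ hθ ↦ hsrc θ hθ
  have hb : ∀ θ : I, (θ₁ : ℝ) ≤ θ → (θ : ℝ) ≤ 1 - θ₁ → h θ ≠ β₁ 0 := by
    intro θ h₁ h₂ heq
    rw [hhap, e] at heq
    have h' := hinj' ⟨θ.2.1, by show (θ : ℝ) < 1; linarith⟩ ⟨le_rfl, zero_lt_one⟩ heq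
    have : (θ : ℝ) = 0 := h'
    linarith
  have hside : (c (h θ₁) - c (β₁ 0)) * (c (h (σ θ₁)) - c (β₁ 0)) < 0 := by
    rw [hhap, hhap, e, coe_symm_eq]
    -- `mul_neg_of_injective_ends` for `v = c ∘ β'`
    have hv : ∀ a b : ℝ, (∀ s ∈ Icc a b, s ∈ Icc (0 : ℝ) 1 ∧ (s ≤ t ∨ 1 - t ≤ s)) →
        ContinuousOn (fun s ↦ c (β' s)) (Icc a b) := fun a b hab ↦
      c.continuousOn.comp hc'.continuousOn fun s hs ↦ by
        obtain ⟨hs01, hs'⟩ := hab s hs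
        exact hsrc ⟨s, hs01⟩ hs'
    have hc₀' : ContinuousOn (fun s ↦ c (β' s)) (Icc 0 t) :=
      hv 0 t fun s hs ↦ ⟨⟨hs.1, hs.2.trans ht₁.le⟩, Or.inl hs.2⟩
    have hc₁' : ContinuousOn (fun s ↦ c (β' s)) (Icc (1 - t) 1) :=
      hv (1 - t) 1 fun s hs ↦ ⟨⟨by linarith [hs.1], hs.2⟩, Or.inr hs.1⟩
    have hv₀ : c (β' 0) = c (β' 0) := rfl
    have hv₁ : c (β' 1) = c (β' 0) := by rw [← zero_add (1 : ℝ), hp' 0]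
    have hinjv : ∀ s ∈ Icc 0 t ∪ Ico (1 - t) 1, ∀ s' ∈ Icc 0 t ∪ Ico (1 - t) 1,
        c (β' s) = c (β' s') → s = s' := by
      have hmem : ∀ s ∈ Icc 0 t ∪ Ico (1 - t) 1, s ∈ Ico (0 : ℝ) 1 ∧ β' s ∈ c.source := by
        rintro s (hs | hs)
        · exact ⟨⟨hs.1, hs.2.trans_lt ht₁⟩, hsrc ⟨s, hs.1, hs.2.trans ht₁.le⟩ (Or.inl hs.2)⟩
        · exact ⟨⟨by linarith [hs.1], hs.2⟩, hsrc ⟨s, by linarith [hs.1], hs.2.le⟩ (Or.inr hs.1)⟩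
      intro s hs s' hs' heq
      obtain ⟨hsI, hsS⟩ := hmem s hs
      obtain ⟨hs'I, hs'S⟩ := hmem s' hs'
      exact hinj' hsI hs'I (c.injOn hsS hs'S heq)
    exact mul_neg_of_injective_ends ht₀ (by linarith) (by linarith) hc₀' hc₁' hv₀ hv₁ hinjv
  -- the criterion
  have hcrit := homotopic_loop_or_revLoop hc₁ hp₁ hinj₁ hsurj₁ hct h ht₀ hthalf ha hb hside
  -- transport the null-homotopy
  have hrefl : (Path.refl (Φ (β₁ 0))).cast (congrArg Φ e.symm) (congrArg Φ e.symm) = Path.refl (Φ (β' 0)) := by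
    ext θ
    exact congrArg Φ e
  have key : (h.map Φ.continuous).Homotopic (Path.refl _) := by
    rcases hcrit with hom | hom
    · exact (hom.map Φ).trans hrebase
    · refine (hom.map Φ).trans ?_
      rw [revLoop_eq_symm, ← Path.map_symm, ← Path.refl_symm]
      exact ⟨Path.Homotopy.symm₂ (Classical.choice hrebase)⟩
  have key' := homotopic_cast (congrArg Φ e.symm) (congrArg Φ e.symm) key
  rw [hrefl] at key'
  have hcast : (h.map Φ.continuous).cast (congrArg Φ e.symm) (congrArg Φ e.symm) = (loop hc' hp').map Φ.continuous := by
    ext θ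
    rfl
  rw [hcast] at key'
  exact key'

end CircleLoops

end Literature.Topology.PlanarFoliations
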